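import Mathlib
import Summits.Ventures.PercRepro2.CoinLsmHead
import Summits.Ventures.PercRepro2.CoinForestLaw
import Summits.Ventures.PercRepro2.CoinForestHead

/-!
# The forest theorem on the LITERAL PATHSTAR — an instantiation check (blind cell PercRepro2,
night-2 g5; NIGHT2-DARC.md §27.4, §19.4)

A concrete coin system on `Fin 9` (s = 0, a = 1, b = 2, u = 3, w = 4, v₁ = 5, v₂ = 6, v₃ = 7,
t = 8) with ten single-arc coins: the pathstar w → v₁ → v₂ → t, w → v₃ → t (arms `c`, route coins
`d`) and five entries / core arcs (s → w, s → a, a → u, u → v₂, b → v₁).  Every STRUCTURAL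
hypothesis of `darc_of_forestHead_mixed` (`SameEnds`, `OnlyForestCoins`, the coin descriptions, the
parent map with its rank, the non-membership conditions) is discharged by `decide`; the theorem then
gives row 2′DARC at the arc `u → w` for EVERY probability vector `p` under the two non-degeneracy
hypotheses `hP`, `hQ` (the reduced avoidance events have positive probability — automatic for
`0 < p e < 1` but left as hypotheses here).  The point of the file: the hypotheses of the forest
theorem are satisfiable and capture the pathstar literally, with `A = {v₁, v₃}` and
`par = (v₁ ↦ v₂, v₂ ↦ t, v₃ ↦ t)`, no phantom coins.
-/

namespace Summit.Ventures.PercRepro2.Coin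

namespace PathStarExample

open Classical

/-- The ten coins of the example. -/
def arcsEx : Fin 10 → Finset (Fin 9 × Fin 9)
  | 0 => {(4, 5)}   -- arm w → v₁
  | 1 => {(4, 7)}   -- arm w → v₃
  | 2 => {(5, 6)}   -- v₁ → v₂
  | 3 => {(6, 8)}   -- v₂ → t
  | 4 => {(7, 8)}   -- v₃ → t
  | 5 => {(0, 4)}   -- s → w
  | 6 => {(0, 1)}   -- s → a
  | 7 => {(1, 3)}   -- a → u
  | 8 => {(3, 6)}   -- u → v₂
  | 9 => {(2, 5)}   -- b → v₁

/-- The arm coins (`v₁ ↦ 0`, `v₃ ↦ 1`; irrelevant elsewhere). -/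
def cEx : Fin 9 → Fin 10 := fun v => if v = 5 then 0 else if v = 7 then 1 else 9

/-- The route coins (`v₁ ↦ 2`, `v₂ ↦ 3`, `v₃ ↦ 4`). -/
def dEx : Fin 9 → Fin 10 := fun v => if v = 5 then 2 else if v = 6 then 3 else if v = 7 then 4 else 9

/-- The parent map of the forest (`v₁ ↦ v₂`, `v₂ ↦ t`, `v₃ ↦ t`). -/
def parEx : Fin 9 → Fin 9 := fun v => if v = 5 then 6 else 8

/-- A rank decreasing along `par` (`v₁ ↦ 2`, `v₂ ↦ 1`, `v₃ ↦ 1`). -/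
def rkEx : Fin 9 → ℕ := fun v => if v = 5 then 2 else 1

/-- The forest vertices. -/
def VsEx : Finset (Fin 9) := {5, 6, 7}

/-- The arm targets. -/
def AEx : Finset (Fin 9) := {5, 7}

/-- Every coin is a single arc, so `SameEnds` holds. -/
lemma sameEnds_ex : SameEnds arcsEx := by
  intro e xy hxy x'y' hx'y'
  fin_cases e <;> simp [arcsEx] at hxy hx'y' <;> subst hxy <;> subst hx'y' <;>
    exact ⟨Or.inl rfl, Or.inr rfl⟩

/-- The arm coins are `{w → v}`. -/
lemma hc_ex : ∀ v ∈ AEx, arcsEx (cEx v) = {(4, v)} := by decide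

/-- The route coins are `{v → par v}`. -/
lemma hd_ex : ∀ v ∈ VsEx, arcsEx (dEx v) = {(v, parEx v)} := by decide

/-- Parents lie in the forest or are `t`. -/
lemma hpar_ex : ∀ v ∈ VsEx, parEx v ∈ VsEx ∨ parEx v = 8 := by decide

/-- The rank decreases along the parent map. -/
lemma hrk_ex : ∀ v ∈ VsEx, parEx v ∈ VsEx → rkEx (parEx v) < rkEx v := by decide

/-- The arm and route coins are the only coins with tails in `{w} ∪ Vs`. -/
lemma honly_ex : OnlyForestCoins arcsEx 4 AEx VsEx cEx dEx := by
  intro e he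
  fin_cases e
  · exact Or.inl ⟨5, by decide, by decide⟩
  · exact Or.inl ⟨7, by decide, by decide⟩
  · exact Or.inr ⟨5, by decide, by decide⟩
  · exact Or.inr ⟨6, by decide, by decide⟩
  · exact Or.inr ⟨7, by decide, by decide⟩
  all_goals simp [arcsEx, VsEx] at he

/-- **Row 2′DARC at the arc `u → w` of the literal pathstar, for every probability vector**
(non-degeneracy of the reduced avoidance events assumed). -/
theorem darc_pathStar_example {R : Type*} [Field R] [LinearOrder R] [IsStrictOrderedRing R]
    (p : Fin 10 → R) (hp : IsProbVec p)
    (hP : ∀ Z ∈ (insert (4 : Fin 9) VsEx).powerset,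
      0 < prob p (avoidEvent (arcsOff arcsEx (insert (4 : Fin 9) VsEx ∪ {8})) 0 (Z ∪ {8})))
    (hQ : ∀ Z ∈ (insert (4 : Fin 9) VsEx).powerset,
      0 < prob p (avoidEvent (arcsOff arcsEx (insert (4 : Fin 9) VsEx ∪ {8})) 0
        (gateTarget 3 4 Z {8}))) :
    DARC p arcsEx 0 {8} 1 2 3 4 :=
  darc_of_forestHead_mixed p hp sameEnds_ex 0 1 2 3 4 8 VsEx (by decide) (by decide) (by decide)
    AEx (by decide) hc_ex hd_ex hpar_ex honly_ex (rk := rkEx) hrk_ex (by decide) (by decide)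
    (by decide) hP hQ

end PathStarExample

end Summit.Ventures.PercRepro2.Coin
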